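import Mathlib.Data.Nat.Choose.Central
import Literature.Computability.AlgebraicComplexity.SDPPCyclicPowerConstruction
import Literature.Computability.AlgebraicComplexity.SDPPOmegaBound
import HarnessLib

/-!
# ω-census, family (b2-D) two families / SDPP: rows R87–R91 and R28 through CKSU Prop. 4.5 + Thm. 4.4

HONEST FRAMING (pub-omega census; verbatim): lottery ticket; floor = certified bounds/negative ranges.
Census BOOKKEEPING for the Cohn–Umans track, not progress on `ω` (the tree proves `ω < 2.373` by the laser
method). Census rows R87–R91 ("(b2-D) CKSU05 Prop. 4.5 SDPP construction (`n = C(2ℓ,ℓ)` pairs in `Cyc_m^{2ℓ}`,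
`|A||B| = (m−1)^{2ℓ}`) via Thm 4.4: `ω ≤ min_m (3ℓ ln m − ln n)/(ℓ ln(m−1))` at `ℓ = 2, 3, 5, 8, 12`"; values
`2.73511, 2.68939, 2.63756, 2.5980, 2.5693`, engine-certified ×3, "bridge (Prop. 4.5 + Thm 4.4) is PRINT") and
R28 ("CKSU Prop 24 / Thm 38, `ω < 2.48` at `m = 6`, `2.4784951…`") are derived here IN THE KERNEL from
* the SDPP family of CKSU Prop. 4.5 / arXiv Prop. 24 PROVED AS PRINTED
  (`Literature/…/SDPPCyclicPowerConstruction.lean`, `CohnKleinbergSzegedyUmans2005_prop24`: `binom(2ℓ,ℓ)` pairs in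
  `C^{2ℓ}` with `|Aᵢ||Bᵢ| = (m−1)^{2ℓ}`, `m = |C|`), and
* CKSU Thm. 4.4 / arXiv Thm. 23 in the ABELIAN case, uniform form `M · L^{ω/2} ≤ |G|^{3/2}`
  (`Literature/…/SDPPOmegaBound.lean`, `IsSDPP.card_mul_rpow_le_of_uniform`, proved along CKSU's §6.2 road:
  triangle-free subsets of `Δₙ` + Thm. 5.5).
Chain (0 facts): `binom(2ℓ,ℓ) · ((m−1)^{2ℓ})^{ω/2} ≤ (m^{2ℓ})^{3/2}`, i.e. for `m ≥ 3`, `ℓ ≥ 1`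
`ω ≤ (3ℓ log m − log binom(2ℓ,ℓ))/(ℓ log(m−1))` (`omega_le_sdpp_closedForm`, the rows' closed form for ALL `m, ℓ`);
the five rows as decimals by integer certificates `m^{3ℓq} ≤ binom(2ℓ,ℓ)^q (m−1)^{pℓ}` (`omega_le_of_sdpp_cert`);
with `binom(2ℓ,ℓ) ≥ 4^ℓ/(2ℓ)`: `ω ≤ (3 log m − 2 log 2)/log(m−1) + log(2ℓ)/(ℓ log(m−1))` (`omega_le_sdpp_explicit`),
hence, `ℓ → ∞`, **`ω ≤ (3 log m − 2 log 2)/log(m−1)`** (`omega_le_cksu_prop24_limit`) — the paper's `(3β−2)/α` with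
"`α = log₂(m−1) + o(1)` and `β = log₂ m + o(1)` as `ℓ → ∞`" — and at `m = 6` the exact closed form
`ω ≤ (3 log 6 − 2 log 2)/log 5` (`omega_le_of_cksuProp24_m6`) with `(3 log 6 − 2 log 2)/log 5 ≤ 2.4785`
(`sdpp_limit_six_le`, certificate `3^30000 · 2^10000 ≤ 5^24785`); the decimal statement `ω ≤ 2.4785` itself is the
tree's `omega_le_of_cksuProp18_m6` (R28's earlier kernel entry through the strong-USP route of §3.3,
`CKSUTriangleOmegaBound.lean` — "Taking `m = 6` yields exactly the same bound as in Subsection 3.3 (`ω < 2.48`)") and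
is not re-declared; this file derives the number by the row's own label.
The sibling `CKSUSDPPWreathOmegaBound.lean` reaches the same limit along CKSU's primary road (Thm. 4.3 wreath
product + Cor. 1.9 + Serre's index bound).

## References
* H. Cohn, R. Kleinberg, B. Szegedy, C. Umans, *Group-theoretic algorithms for matrix multiplication*, FOCS 2005;
  arXiv:math/0511460, §4: Prop. 4.5 / 24, Thm. 4.4 / 23 and the `α, β` sentence after it (p. 8).
  [CohnKleinbergSzegedyUmans2005]
-/

noncomputable section

namespace Summit.MatrixMultiplication.OmegaCensus

open Finset Filter Topology Literature.Computability.AlgebraicComplexity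
  Literature.Computability.AlgebraicComplexity.SDPPCyclicPower

/-! ### The closed form of rows R87–R91 for all `m ≥ 3`, `ℓ ≥ 1` -/

/-- **CKSU Prop. 4.5 fed to the abelian Thm. 4.4: `ω ≤ (3ℓ log m − log binom(2ℓ,ℓ))/(ℓ log(m−1))`** for every
finite abelian `C` with `m = |C| ≥ 3` and every `ℓ ≥ 1` (from `binom(2ℓ,ℓ) · ((m−1)^{2ℓ})^{ω/2} ≤ (m^{2ℓ})^{3/2}`).
[cite: CohnKleinbergSzegedyUmans2005, Prop. 4.5 and Thm. 4.4] -/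
theorem omega_le_sdpp_closedForm (C : Type) [AddCommGroup C] [Fintype C] [DecidableEq C]
    (hm : 3 ≤ Fintype.card C) {ℓ : ℕ} (hℓ : 1 ≤ ℓ) :
    omega ℂ ≤ (3 * ℓ * Real.log (Fintype.card C) - Real.log ((2 * ℓ).choose ℓ)) /
      (ℓ * Real.log ((Fintype.card C : ℝ) - 1)) := by
  obtain ⟨A, B, hS, hcard⟩ := CohnKleinbergSzegedyUmans2005_prop24 C ℓ
  have h := hS.card_mul_rpow_le_of_uniform hcard
  rw [Fintype.card_fun, Fintype.card_fin] at h
  set m := Fintype.card C with hmdef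
  set n := (2 * ℓ).choose ℓ with hn
  have h3 : (3 : ℝ) ≤ m := by exact_mod_cast hm
  have hm1 : ((m - 1 : ℕ) : ℝ) = (m : ℝ) - 1 := by
    rw [Nat.cast_sub (by omega), Nat.cast_one]
  have hL : 0 < Real.log ((m : ℝ) - 1) := Real.log_pos (by linarith)
  have hℓr : (0 : ℝ) < ℓ := by exact_mod_cast hℓ
  have hnr : (0 : ℝ) < n := by exact_mod_cast Nat.choose_pos (by omega)
  push_cast at h
  rw [hm1] at h
  have hm1pos : (0 : ℝ) < (m : ℝ) - 1 := by linarith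
  have hmpos : (0 : ℝ) < m := by linarith
  have hlog := Real.log_le_log (by positivity) h
  rw [Real.log_mul hnr.ne' (by positivity), Real.log_rpow (by positivity), Real.log_rpow (by positivity),
    Real.log_pow, Real.log_pow] at hlog
  push_cast at hlog
  rw [le_div_iff₀ (by positivity)]
  nlinarith [hlog, hL, hℓr]

/-- **Decimal certificates for the rows**: if `m^{3ℓq} ≤ binom(2ℓ,ℓ)^q · (m−1)^{pℓ}` (integers), then
`ω ≤ p/q` (`C = ℤ/m`). [cite: CohnKleinbergSzegedyUmans2005, Prop. 4.5 and Thm. 4.4] -/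
theorem omega_le_of_sdpp_cert {m ℓ p q : ℕ} (hm : 3 ≤ m) (hℓ : 1 ≤ ℓ) (hq : 0 < q)
    (hcert : m ^ (3 * ℓ * q) ≤ (2 * ℓ).choose ℓ ^ q * (m - 1) ^ (p * ℓ)) :
    omega ℂ ≤ (p : ℝ) / q := by
  haveI : NeZero m := ⟨by omega⟩
  have h := omega_le_sdpp_closedForm (ZMod m) (by rw [ZMod.card]; exact hm) hℓ
  rw [ZMod.card] at h
  have h3 : (3 : ℝ) ≤ m := by exact_mod_cast hm
  have hL : 0 < Real.log ((m : ℝ) - 1) := Real.log_pos (by linarith)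
  have hℓr : (0 : ℝ) < ℓ := by exact_mod_cast hℓ
  have hqr : (0 : ℝ) < q := by exact_mod_cast hq
  have hm1 : ((m - 1 : ℕ) : ℝ) = (m : ℝ) - 1 := by
    rw [Nat.cast_sub (by omega), Nat.cast_one]
  have hm1pos : (0 : ℝ) < (m : ℝ) - 1 := by linarith
  have hnr : (0 : ℝ) < ((2 * ℓ).choose ℓ : ℕ) := by exact_mod_cast Nat.choose_pos (by omega)
  have hcr : (m : ℝ) ^ (3 * ℓ * q) ≤ (((2 * ℓ).choose ℓ : ℕ) : ℝ) ^ q * ((m : ℝ) - 1) ^ (p * ℓ) := by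
    rw [← hm1]; exact_mod_cast hcert
  have hlog := Real.log_le_log (by positivity) hcr
  rw [Real.log_pow, Real.log_mul (by positivity) (by positivity), Real.log_pow, Real.log_pow] at hlog
  push_cast at hlog
  refine h.trans ?_
  rw [div_le_div_iff₀ (by positivity) hqr]
  nlinarith [hlog, hL, hℓr, hqr]

/-! ### Rows R87–R91 as decimals (`5` / `4` dp up, the census values) -/

/-- **R87**: `ℓ = 2` (`n = 6`), `m* = 11`: `(6 ln 11 − ln 6)/(2 ln 10) = 2.7351024…`, so `ω ≤ 2.73511`
(certificate `11^600000 ≤ 6^100000 · 10^547022`). [cite: CohnKleinbergSzegedyUmans2005, Prop. 4.5 and Thm. 4.4] -/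
theorem omega_le_sdpp_row87 : omega ℂ ≤ 2.73511 := by
  have h := omega_le_of_sdpp_cert (m := 11) (ℓ := 2) (p := 273511) (q := 100000) (by norm_num) (by norm_num)
    (by norm_num) (by decide +kernel)
  exact h.trans (by norm_num)

/-- **R88**: `ℓ = 3` (`n = 20`), `m* = 10`: `(9 ln 10 − ln 20)/(3 ln 9) = 2.6893827…`, so `ω ≤ 2.68939`
(certificate `10^900000 ≤ 20^100000 · 9^806817`). [cite: CohnKleinbergSzegedyUmans2005, Prop. 4.5 and Thm. 4.4] -/
theorem omega_le_sdpp_row88 : omega ℂ ≤ 2.68939 := by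
  have h := omega_le_of_sdpp_cert (m := 10) (ℓ := 3) (p := 268939) (q := 100000) (by norm_num) (by norm_num)
    (by norm_num) (by decide +kernel)
  exact h.trans (by norm_num)

/-- **R89**: `ℓ = 5` (`n = 252`), `m* = 8`: `(15 ln 8 − ln 252)/(5 ln 7) = 2.6375517…`, so `ω ≤ 2.63756`
(certificate `8^375000 ≤ 252^25000 · 7^329695`, i.e. `p/q = 65939/25000`).
[cite: CohnKleinbergSzegedyUmans2005, Prop. 4.5 and Thm. 4.4] -/
theorem omega_le_sdpp_row89 : omega ℂ ≤ 2.63756 := by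
  have h := omega_le_of_sdpp_cert (m := 8) (ℓ := 5) (p := 65939) (q := 25000) (by norm_num) (by norm_num)
    (by norm_num) (by decide +kernel)
  exact h.trans (by norm_num)

/-- **R90**: `ℓ = 8` (`n = 12870`), `m* = 7`: `(24 ln 7 − ln 12870)/(8 ln 6) = 2.5979484…`, so `ω ≤ 2.5980`
(certificate `7^12000 ≤ 12870^500 · 6^10392`, i.e. `p/q = 1299/500`).
[cite: CohnKleinbergSzegedyUmans2005, Prop. 4.5 and Thm. 4.4] -/
theorem omega_le_sdpp_row90 : omega ℂ ≤ 2.5980 := by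
  have h := omega_le_of_sdpp_cert (m := 7) (ℓ := 8) (p := 1299) (q := 500) (by norm_num) (by norm_num)
    (by norm_num) (by decide +kernel)
  exact h.trans (by norm_num)

/-- **R91**: `ℓ = 12` (`n = 2704156`), `m* = 7`: `(36 ln 7 − ln 2704156)/(12 ln 6) = 2.5692838…`, so `ω ≤ 2.5693`
(certificate `7^360000 ≤ 2704156^10000 · 6^308316`). [cite: CohnKleinbergSzegedyUmans2005, Prop. 4.5 and Thm. 4.4] -/
theorem omega_le_sdpp_row91 : omega ℂ ≤ 2.5693 := by
  have h := omega_le_of_sdpp_cert (m := 7) (ℓ := 12) (p := 25693) (q := 10000) (by norm_num) (by norm_num)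
    (by norm_num) (by decide +kernel)
  exact h.trans (by norm_num)

/-! ### `ℓ → ∞`: the printed `(3β − 2)/α` with `α = log₂(m−1)`, `β = log₂ m`, and R28 -/

/-- **Explicit in `ℓ`**: `ω ≤ (3 log m − 2 log 2)/log(m−1) + log(2ℓ)/(ℓ log(m−1))` for `m = |C| ≥ 3`, `ℓ ≥ 1`
(the closed form with `binom(2ℓ,ℓ) ≥ 4^ℓ/(2ℓ)`, Mathlib `Nat.four_pow_le_two_mul_self_mul_centralBinom`).
[cite: CohnKleinbergSzegedyUmans2005, Prop. 4.5 and Thm. 4.4] -/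
theorem omega_le_sdpp_explicit (C : Type) [AddCommGroup C] [Fintype C] [DecidableEq C]
    (hm : 3 ≤ Fintype.card C) {ℓ : ℕ} (hℓ : 1 ≤ ℓ) :
    omega ℂ ≤ (3 * Real.log (Fintype.card C) - 2 * Real.log 2) / Real.log ((Fintype.card C : ℝ) - 1) +
      Real.log (2 * ℓ) / (ℓ * Real.log ((Fintype.card C : ℝ) - 1)) := by
  have h := omega_le_sdpp_closedForm C hm hℓ
  set m := Fintype.card C with hmdef
  set n := (2 * ℓ).choose ℓ with hn
  have h3 : (3 : ℝ) ≤ m := by exact_mod_cast hm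
  have hL : 0 < Real.log ((m : ℝ) - 1) := Real.log_pos (by linarith)
  have hℓr : (0 : ℝ) < ℓ := by exact_mod_cast hℓ
  have hnr : (0 : ℝ) < n := by exact_mod_cast Nat.choose_pos (by omega)
  -- `log n ≥ 2ℓ log 2 − log(2ℓ)` from `4^ℓ ≤ 2ℓ·binom(2ℓ,ℓ)`
  have h4 : 4 ^ ℓ ≤ 2 * ℓ * n := by
    have := Nat.four_pow_le_two_mul_self_mul_centralBinom ℓ hℓ
    rwa [Nat.centralBinom_eq_two_mul_choose] at this
  have h4r : (4 : ℝ) ^ ℓ ≤ 2 * ℓ * n := by exact_mod_cast h4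
  have hlogn : 2 * ℓ * Real.log 2 - Real.log (2 * ℓ) ≤ Real.log n := by
    have := Real.log_le_log (by positivity) h4r
    rw [Real.log_pow, Real.log_mul (by positivity) hnr.ne',
      show (4 : ℝ) = 2 ^ 2 by norm_num, Real.log_pow] at this
    push_cast at this
    linarith
  rw [le_div_iff₀ (by positivity)] at h
  have e : (3 * Real.log m - 2 * Real.log 2) / Real.log ((m : ℝ) - 1) +
      Real.log (2 * ℓ) / (ℓ * Real.log ((m : ℝ) - 1)) =
      (3 * ℓ * Real.log m - 2 * ℓ * Real.log 2 + Real.log (2 * ℓ)) / (ℓ * Real.log ((m : ℝ) - 1)) := by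
    field_simp
  rw [e, le_div_iff₀ (by positivity)]
  linarith

/-- The limiting step, once: if `ω ≤ X + f ℓ` for every `ℓ ≥ 1` and `f ℓ → 0`, then `ω ≤ X`. [folklore] -/
theorem omega_le_of_forall_le_add {X : ℝ} {f : ℕ → ℝ} (hf : Tendsto f atTop (𝓝 0))
    (h : ∀ ℓ : ℕ, 1 ≤ ℓ → omega ℂ ≤ X + f ℓ) : omega ℂ ≤ X := by
  refine le_of_forall_pos_le_add fun ε hε => ?_
  obtain ⟨ℓ, hℓε, hℓ1⟩ := ((hf.eventually (gt_mem_nhds hε)).and (eventually_ge_atTop 1)).exists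
  exact (h ℓ hℓ1).trans (by linarith)

/-- `log(2ℓ)/(ℓ L) → 0`. [folklore] -/
private theorem tendsto_log_two_mul_div (L : ℝ) :
    Tendsto (fun ℓ : ℕ => Real.log (2 * ℓ) / (ℓ * L)) atTop (𝓝 0) := by
  rcases eq_or_ne L 0 with hL | hL
  · subst hL; simp
  have h1 : Tendsto (fun x : ℝ => Real.log x ^ 1 / (1 * x + 0)) atTop (𝓝 0) :=
    Real.tendsto_pow_log_div_mul_add_atTop 1 0 1 one_ne_zero
  have h2 : Tendsto (fun ℓ : ℕ => (2 : ℝ) * ℓ) atTop atTop :=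
    tendsto_natCast_atTop_atTop.const_mul_atTop (by norm_num)
  have h3 := (h1.comp h2).const_mul (2 / L)
  rw [mul_zero] at h3
  refine h3.congr' ?_
  filter_upwards [eventually_ge_atTop 1] with ℓ hℓ
  have hℓr : (0 : ℝ) < ℓ := by exact_mod_cast hℓ
  simp only [Function.comp_def, pow_one, one_mul, add_zero]
  field_simp

/-- **CKSU Prop. 4.5 through Thm. 4.4, `ℓ → ∞`: `ω ≤ (3 log m − 2 log 2)/log(m−1)`** for every finite abelian `C`
with `m = |C| ≥ 3` — the paper's `ω ≤ (3β−2)/α` with `α = log₂(m−1)`, `β = log₂ m` ("α = log₂(m−1) + o(1) and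
β = log₂ m + o(1) as ℓ → ∞"); at `m = 6`: `3(log 6 − (2/3) log 2)/log 5 = 2.47849…` = census R28; the rows
R87–R91 decrease to this value. [cite: CohnKleinbergSzegedyUmans2005, Prop. 4.5 and Thm. 4.4] -/
theorem omega_le_cksu_prop24_limit (C : Type) [AddCommGroup C] [Fintype C] [DecidableEq C]
    (hm : 3 ≤ Fintype.card C) :
    omega ℂ ≤ (3 * Real.log (Fintype.card C) - 2 * Real.log 2) / Real.log ((Fintype.card C : ℝ) - 1) :=
  omega_le_of_forall_le_add (tendsto_log_two_mul_div _) fun _ hℓ => omega_le_sdpp_explicit C hm hℓ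

/-- The `m = 6` value: `(3 log 6 − 2 log 2)/log 5 ≤ 2.4785` (exact `2.4784951…`; certificate
`3^30000 · 2^10000 ≤ 5^24785`; `2.4784` fails). [cite: CohnKleinbergSzegedyUmans2005, Prop. 4.5] -/
theorem sdpp_limit_six_le : (3 * Real.log 6 - 2 * Real.log 2) / Real.log 5 ≤ 2.4785 := by
  have h6 : Real.log 6 = Real.log 2 + Real.log 3 := by
    rw [show (6 : ℝ) = 2 * 3 by norm_num, Real.log_mul (by norm_num) (by norm_num)]
  have hlog5 : 0 < Real.log 5 := Real.log_pos (by norm_num)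
  have hpow : (3 : ℝ) ^ 30000 * (2 : ℝ) ^ 10000 ≤ (5 : ℝ) ^ 24785 := by
    have : (3 ^ 30000 * 2 ^ 10000 : ℕ) ≤ 5 ^ 24785 := by decide +kernel
    exact_mod_cast this
  have hlogs : 30000 * Real.log 3 + 10000 * Real.log 2 ≤ 24785 * Real.log 5 := by
    have := Real.log_le_log (by positivity) hpow
    rwa [Real.log_mul (by positivity) (by positivity), Real.log_pow, Real.log_pow, Real.log_pow] at this
  rw [h6, div_le_iff₀ hlog5]
  nlinarith [hlogs, hlog5]

/-- Census row R28 by its own label at KERNEL grade, exact closed form: **`ω ≤ (3 log 6 − 2 log 2)/log 5`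
(`= 2.4784951…`) from the SDPP construction of CKSU Prop. 4.5 with `m = 6`** through the abelian Thm. 4.4.
The decimal `ω ≤ 2.4785` is `omega_le_of_cksuProp24_m6.trans sdpp_limit_six_le` — as a statement it is
literally the tree's `omega_le_of_cksuProp18_m6` (strong-USP route of §3.3; "Taking `m = 6` yields exactly
the same bound as in Subsection 3.3 (`ω < 2.48`)"), so it is not re-declared here.
[cite: CohnKleinbergSzegedyUmans2005, Prop. 4.5 (arXiv Prop. 24)] -/
theorem omega_le_of_cksuProp24_m6 : omega ℂ ≤ (3 * Real.log 6 - 2 * Real.log 2) / Real.log 5 := by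
  have h := omega_le_cksu_prop24_limit (ZMod 6) (by rw [ZMod.card]; norm_num)
  rw [ZMod.card] at h
  have h5 : Real.log (((6 : ℕ) : ℝ) - 1) = Real.log 5 := by norm_num
  rwa [h5, Nat.cast_ofNat] at h

end Summit.MatrixMultiplication.OmegaCensus

end
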